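import Summits.Ventures.PercRepro.C025ProfileStagedDemCap
import Summits.Ventures.PercRepro.C025ProfileThreeFourReduce

/-!
# THE ROW `(3,4)` OF `(Π)` FOR EVERY FINITE MATROID, MODULO THE RIGID BOUND ON SIMPLE MATROIDS OF RANK `≥ 5` (night-3 g12)
`proofs/NIGHT3-G12-STAGED.md` §4 and §9. The rule-free reduction `profileIneq_three_four_of_simple_five`
(`C025ProfileThreeFourReduce`) brings the row to simple matroids of rank `≥ 5`; there the staged certificate closes it as soon as
`RigidBound` holds (`profileIneq_three_four_of_rigid`, `C025ProfileStagedDemCap`). So **`profileIneq_three_four_of_rigidBound`**: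
`RigidBound` on simple matroids of rank `≥ 5` ⟹ `Profile.ProfileIneq M 3 4` for EVERY finite matroid `M`. `RigidBound` is FALSE on
some matroids with a `7`-point line (§6) but census-clean on every matroid with all lines `≤ 3` points (§9.3) — the class to which
the row reduces by the cell's Theorem A (p10: the row `q = 3` lifts over every point of a `≥ 4`-point line).
-/
open scoped Matroid
namespace PercRepro
open Set Finset ThmH
namespace Staged
variable {α : Type} [DecidableEq α]

/-- **THE ROW `(3,4)` OF `(Π)` FOR EVERY FINITE MATROID, MODULO THE RIGID BOUND ON SIMPLE MATROIDS OF RANK `≥ 5`.** -/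
theorem profileIneq_three_four_of_rigidBound
    (h : ∀ (N : Matroid α) [N.Finite], (∀ T ⊆ N.E, T.encard ≤ 2 → N.Indep T) → (5 : ℕ∞) ≤ N.eRank →
      RigidBound N)
    (M : Matroid α) [M.Finite] : Profile.ProfileIneq M 3 4 :=
  profileIneq_three_four_of_simple_five
    (fun N _ hs hR => profileIneq_three_four_of_rigid N (h N hs hR)) M

end Staged
end PercRepro
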